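import Summits.CriticalPhenomena.PercolationContinuityZ3.Theorems.PercNearOneGluingNoHeavyLowerTailFrontierDecRowsClusterMarkovMono
import HarnessLib

/-!
# Conjecture G⁺ for HITTING-type `B = {t ↔ y}`: the decomposition `E₃ = E₃(·,·,b') + E₃(·,·,b'')`, the nonnegative part, and the
# explicit signed part — a proved lower bound and a sufficient condition for the PATH-type rows on EVERY finite weighted graph

Support file (prover prim-ineq-prove-3 gen 12; `--supports stmt-CriticalPhenomena-4575`).  No definitions, no named facts, no sorries,
no `native_decide`.  New mathematics (not in print); memo FINDING-G12-HITTING-DECOMPOSITION.md (prim-ineq-prove-3 HOME).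

Setting: `μ = prodBernoulli w`, a source vertex `s`, a terminal set `T`, a vertex `y`, an event `A` that is an increasing function of the open
edge cluster `C_s` (the hypothesis class of `FrontierDecRows.ClusterBHK3Pos`), `D = {s ↮ T}`, `a = Aᶜ`, and the hitting-type third event
`b = {y ↮ T}` (the complement of `B = {C_T ∋ y}`, increasing in `C_T`).  Split `b` according to whether `y` is joined to `s`:
`b' = {y ↮ {s} ∪ T}`, `b'' = {y ↔ s} ∩ {y ↮ T}`, `b = b' ⊔ b''`, and `b'' ⊆ D`.  Then (linearity of `E₃` in its third slot)

  `E₃(D, a, b) = E₃(D, a, b') + E₃(D, a, b'')`,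
  `E₃(D, a, b') ≥ 0`            — `ClusterMarkovE3.sahiE3_sep_clusterMonoCompl_notReachUnion_nonneg` (the generalised cluster-Markov
                                   criterion of `…FrontierDecRowsClusterMarkovMono`, conditioning on the cluster of `y`),
  `E₃(D, a, b'') = (2 − μ(D))·μ(a ∩ b'') − ((1 − μ(D))·μ(a) + μ(D ∩ a))·μ(b'')`   (because `b'' ⊆ D`).

Hence the PROVED lower bound (`sahiE3_sep_clusterMonoCompl_notReach_ge`)
  `E₃({s↮T}, Aᶜ, {y↮T}) ≥ (2 − μ(D))·μ(Aᶜ ∩ {s↔y↮T}) − ((1 − μ(D))·μ(Aᶜ) + μ(D ∩ Aᶜ))·μ({s↔y↮T})`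
and the SUFFICIENT CONDITION (`sahiE3_sep_clusterMonoCompl_notReach_nonneg_of_le`): the hitting-type instance of G⁺ holds as soon as
`((1−μ(D))μ(Aᶜ) + μ(D∩Aᶜ))·μ({s↔y↮T}) ≤ (2−μ(D))·μ(Aᶜ ∩ {s↔y↮T})`, i.e. `P(Aᶜ | s↔y↮T) ≥ (u·P(Aᶜ) + P(D∩Aᶜ))/(1+u)` ("`y` does not
attract `A`").  For the open PATH row `(D[s|t], D[s|x], D[t|y])` (orbit 36 of `…FrontierDecRowsLeFive`, open for general `n`) this reads
(`frontier_path_all_of_le`):  `0 ≤ E₃({s↮t},{s↮x},{t↮y})` whenever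
`((1−P(s↮t))·P(s↮x) + P(s↮t, s↮x))·P(s↔y, y↮t) ≤ (2−P(s↮t))·P(s↮x, s↔y, y↮t)`.
The signed summand `E₃(D,a,b'')` is a ONE-SOURCE quantity (all three events are functions of `C_s`); the memo's census shows it is negative
in ≈ 40 % of random instances, where it is paid for by `E₃(D,a,b')` (sharpened row S⁺ of the memo, census-clean, open).
-/

noncomputable section

namespace Summit.CriticalPhenomena.PercolationContinuityZ3.Theorems

namespace ClusterBHK3Hitting

open MeasureTheory Literature.Probability.Percolation Literature.Probability.LatticeModels
open scoped Classical

variable {V : Type*} [Fintype V]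

/-! ### Linearity of `E₃` in the third slot -/

/-- `E₃(A, B, C₁ ⊔ C₂) = E₃(A, B, C₁) + E₃(A, B, C₂)` for disjoint `C₁, C₂` under a probability measure (finite vertex type, so every
event is measurable). [folklore] -/
theorem sahiE3_union_right (μ : Measure (BondConfig V)) [IsProbabilityMeasure μ] (A B C₁ C₂ : Set (BondConfig V))
    (hdisj : Disjoint C₁ C₂) (hC₂ : MeasurableSet C₂) :
    sahiE3 μ A B (C₁ ∪ C₂) = sahiE3 μ A B C₁ + sahiE3 μ A B C₂ := by
  have h1 : μ.real (C₁ ∪ C₂) = μ.real C₁ + μ.real C₂ := measureReal_union hdisj hC₂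
  have h2 : μ.real (A ∩ B ∩ (C₁ ∪ C₂)) = μ.real (A ∩ B ∩ C₁) + μ.real (A ∩ B ∩ C₂) := by
    rw [Set.inter_union_distrib_left]
    exact measureReal_union (hdisj.mono Set.inter_subset_right Set.inter_subset_right) (MeasurableSet.of_discrete)
  have h3 : μ.real (A ∩ (C₁ ∪ C₂)) = μ.real (A ∩ C₁) + μ.real (A ∩ C₂) := by
    rw [Set.inter_union_distrib_left]
    exact measureReal_union (hdisj.mono Set.inter_subset_right Set.inter_subset_right) (MeasurableSet.of_discrete)
  have h4 : μ.real (B ∩ (C₁ ∪ C₂)) = μ.real (B ∩ C₁) + μ.real (B ∩ C₂) := by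
    rw [Set.inter_union_distrib_left]
    exact measureReal_union (hdisj.mono Set.inter_subset_right Set.inter_subset_right) (MeasurableSet.of_discrete)
  simp only [sahiE3_def]
  rw [h1, h2]
  rw [show B ∩ (C₁ ∪ C₂) = B ∩ (C₁ ∪ C₂) from rfl, h4, h3]
  ring

omit [Fintype V] in
/-- **`E₃(D, a, c)` for `c ⊆ D`**: `E₃(D, a, c) = (2 − μ D)·μ(a ∩ c) − ((1 − μ D)·μ a + μ(D ∩ a))·μ c`. [this work] -/
theorem sahiE3_of_subset_left (μ : Measure (BondConfig V)) (D a c : Set (BondConfig V)) (hc : c ⊆ D) :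
    sahiE3 μ D a c = (2 - μ.real D) * μ.real (a ∩ c) - ((1 - μ.real D) * μ.real a + μ.real (D ∩ a)) * μ.real c := by
  have h1 : D ∩ a ∩ c = a ∩ c := by
    ext ω; constructor
    · rintro ⟨⟨_, ha⟩, hω⟩; exact ⟨ha, hω⟩
    · rintro ⟨ha, hω⟩; exact ⟨⟨hc hω, ha⟩, hω⟩
  have h2 : D ∩ c = c := Set.inter_eq_right.2 hc
  simp only [sahiE3_def, h1, h2]
  ring

/-! ### The events and the decomposition -/

omit [Fintype V] in
/-- `{y ↮ T} = {y ↮ {s} ∪ T} ∪ ({y ↔ s} ∩ {y ↮ T})`. [folklore] -/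
theorem notReach_eq_union (s y : V) (T : Set V) :
    {ω : BondConfig V | ∀ t ∈ T, ¬ (openGraph ω).Reachable y t} =
      {ω : BondConfig V | ∀ x ∈ ({s} : Set V) ∪ T, ¬ (openGraph ω).Reachable y x} ∪
        ({ω : BondConfig V | (openGraph ω).Reachable y s} ∩ {ω : BondConfig V | ∀ t ∈ T, ¬ (openGraph ω).Reachable y t}) := by
  ext ω
  simp only [Set.mem_setOf_eq, Set.mem_union, Set.mem_inter_iff, Set.mem_singleton_iff]
  constructor
  · intro h
    by_cases hys : (openGraph ω).Reachable y s
    · exact Or.inr ⟨hys, h⟩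
    · refine Or.inl fun x hx => ?_
      rcases hx with hx | hx
      · rw [hx]; exact hys
      · exact h x hx
  · rintro (h | ⟨_, h⟩)
    · exact fun t ht => h t (Or.inr ht)
    · exact h

omit [Fintype V] in
/-- The two parts are disjoint. [folklore] -/
theorem disjoint_parts (s y : V) (T : Set V) :
    Disjoint {ω : BondConfig V | ∀ x ∈ ({s} : Set V) ∪ T, ¬ (openGraph ω).Reachable y x}
      ({ω : BondConfig V | (openGraph ω).Reachable y s} ∩ {ω : BondConfig V | ∀ t ∈ T, ¬ (openGraph ω).Reachable y t}) := by
  rw [Set.disjoint_left]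
  rintro ω hω ⟨hys, _⟩
  exact hω s (Or.inl rfl) hys

omit [Fintype V] in
/-- `{y ↔ s} ∩ {y ↮ T} ⊆ {s ↮ T}`: if `s` reached some `t ∈ T` then so would `y`. [folklore] -/
theorem parts_subset_sep (s y : V) (T : Set V) :
    ({ω : BondConfig V | (openGraph ω).Reachable y s} ∩ {ω : BondConfig V | ∀ t ∈ T, ¬ (openGraph ω).Reachable y t}) ⊆
      {ω : BondConfig V | ∀ p ∈ ({s} : Set V), ∀ q ∈ T, ¬ (openGraph ω).Reachable p q} := by
  rintro ω ⟨hys, hyT⟩ p hp q hq hpq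
  rw [Set.mem_singleton_iff] at hp
  subst hp
  exact hyT q hq (hys.trans hpq)

/-- **The hitting decomposition**: `E₃({s↮T}, Aᶜ, {y↮T}) = E₃({s↮T}, Aᶜ, {y↮ {s}∪T}) + E₃({s↮T}, Aᶜ, {y↔s}∩{y↮T})`. [this work] -/
theorem sahiE3_hitting_decomposition (w : Sym2 V → unitInterval) (s y : V) (T : Set V) (A : Set (BondConfig V)) :
    sahiE3 (prodBernoulli w) {ω : BondConfig V | ∀ p ∈ ({s} : Set V), ∀ q ∈ T, ¬ (openGraph ω).Reachable p q} Aᶜ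
        {ω : BondConfig V | ∀ t ∈ T, ¬ (openGraph ω).Reachable y t} =
      sahiE3 (prodBernoulli w) {ω : BondConfig V | ∀ p ∈ ({s} : Set V), ∀ q ∈ T, ¬ (openGraph ω).Reachable p q} Aᶜ
          {ω : BondConfig V | ∀ x ∈ ({s} : Set V) ∪ T, ¬ (openGraph ω).Reachable y x} +
        sahiE3 (prodBernoulli w) {ω : BondConfig V | ∀ p ∈ ({s} : Set V), ∀ q ∈ T, ¬ (openGraph ω).Reachable p q} Aᶜ
          ({ω : BondConfig V | (openGraph ω).Reachable y s} ∩ {ω : BondConfig V | ∀ t ∈ T, ¬ (openGraph ω).Reachable y t}) := by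
  conv_lhs => rw [notReach_eq_union s y T]
  exact sahiE3_union_right _ _ _ _ _ (disjoint_parts s y T) MeasurableSet.of_discrete

omit [Fintype V] in
/-- **The signed part in closed form**: with `D = {s↮T}`, `a = Aᶜ`, `b'' = {y↔s}∩{y↮T}` (`⊆ D`),
`E₃(D, a, b'') = (2 − μ D)·μ(a ∩ b'') − ((1 − μ D)·μ a + μ(D ∩ a))·μ b''`. [this work] -/
theorem sahiE3_signedPart_eq (w : Sym2 V → unitInterval) (s y : V) (T : Set V) (A : Set (BondConfig V)) :
    sahiE3 (prodBernoulli w) {ω : BondConfig V | ∀ p ∈ ({s} : Set V), ∀ q ∈ T, ¬ (openGraph ω).Reachable p q} Aᶜ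
        ({ω : BondConfig V | (openGraph ω).Reachable y s} ∩ {ω : BondConfig V | ∀ t ∈ T, ¬ (openGraph ω).Reachable y t}) =
      (2 - (prodBernoulli w).real {ω : BondConfig V | ∀ p ∈ ({s} : Set V), ∀ q ∈ T, ¬ (openGraph ω).Reachable p q}) *
          (prodBernoulli w).real (Aᶜ ∩ ({ω : BondConfig V | (openGraph ω).Reachable y s} ∩
            {ω : BondConfig V | ∀ t ∈ T, ¬ (openGraph ω).Reachable y t})) -
        ((1 - (prodBernoulli w).real {ω : BondConfig V | ∀ p ∈ ({s} : Set V), ∀ q ∈ T, ¬ (openGraph ω).Reachable p q}) *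
            (prodBernoulli w).real Aᶜ +
          (prodBernoulli w).real ({ω : BondConfig V | ∀ p ∈ ({s} : Set V), ∀ q ∈ T, ¬ (openGraph ω).Reachable p q} ∩ Aᶜ)) *
          (prodBernoulli w).real ({ω : BondConfig V | (openGraph ω).Reachable y s} ∩
            {ω : BondConfig V | ∀ t ∈ T, ¬ (openGraph ω).Reachable y t}) :=
  sahiE3_of_subset_left _ _ _ _ (parts_subset_sep s y T)

/-! ### The lower bound and the sufficient condition -/

/-- **PROVED LOWER BOUND for the hitting-type instances of G⁺.**  For `A` increasing in `C_s`, a terminal set `T` and a vertex `y`: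
`E₃({s↮T}, Aᶜ, {y↮T}) ≥ (2 − μ D)·μ(Aᶜ ∩ {s↔y↮T}) − ((1 − μ D)·μ(Aᶜ) + μ(D ∩ Aᶜ))·μ({s↔y↮T})`, `D = {s↮T}`. [this work] -/
theorem sahiE3_sep_clusterMonoCompl_notReach_ge (w : Sym2 V → unitInterval) (s y : V) (T : Set V) (A : Set (BondConfig V))
    (hA : ∀ ⦃ω ω' : BondConfig V⦄,
      (⋃ v ∈ ({s} : Set V), openEdgeCluster ω v) ⊆ (⋃ v ∈ ({s} : Set V), openEdgeCluster ω' v) → ω ∈ A → ω' ∈ A) :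
    (2 - (prodBernoulli w).real {ω : BondConfig V | ∀ p ∈ ({s} : Set V), ∀ q ∈ T, ¬ (openGraph ω).Reachable p q}) *
          (prodBernoulli w).real (Aᶜ ∩ ({ω : BondConfig V | (openGraph ω).Reachable y s} ∩
            {ω : BondConfig V | ∀ t ∈ T, ¬ (openGraph ω).Reachable y t})) -
        ((1 - (prodBernoulli w).real {ω : BondConfig V | ∀ p ∈ ({s} : Set V), ∀ q ∈ T, ¬ (openGraph ω).Reachable p q}) *
            (prodBernoulli w).real Aᶜ +
          (prodBernoulli w).real ({ω : BondConfig V | ∀ p ∈ ({s} : Set V), ∀ q ∈ T, ¬ (openGraph ω).Reachable p q} ∩ Aᶜ)) *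
          (prodBernoulli w).real ({ω : BondConfig V | (openGraph ω).Reachable y s} ∩
            {ω : BondConfig V | ∀ t ∈ T, ¬ (openGraph ω).Reachable y t}) ≤
      sahiE3 (prodBernoulli w) {ω : BondConfig V | ∀ p ∈ ({s} : Set V), ∀ q ∈ T, ¬ (openGraph ω).Reachable p q} Aᶜ
        {ω : BondConfig V | ∀ t ∈ T, ¬ (openGraph ω).Reachable y t} := by
  rw [sahiE3_hitting_decomposition, ← sahiE3_signedPart_eq]
  have hnn := ClusterMarkovE3.sahiE3_sep_clusterMonoCompl_notReachUnion_nonneg w ({s} : Set V) T y A hA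
  linarith

/-- **SUFFICIENT CONDITION** ("`y` does not attract `A`"): if
`((1 − μ D)·μ(Aᶜ) + μ(D ∩ Aᶜ))·μ({s↔y↮T}) ≤ (2 − μ D)·μ(Aᶜ ∩ {s↔y↮T})`, then the hitting-type instance of Conjecture G⁺ holds:
`0 ≤ E₃({s↮T}, Aᶜ, {y↮T})`. [this work] -/
theorem sahiE3_sep_clusterMonoCompl_notReach_nonneg_of_le (w : Sym2 V → unitInterval) (s y : V) (T : Set V)
    (A : Set (BondConfig V))
    (hA : ∀ ⦃ω ω' : BondConfig V⦄,
      (⋃ v ∈ ({s} : Set V), openEdgeCluster ω v) ⊆ (⋃ v ∈ ({s} : Set V), openEdgeCluster ω' v) → ω ∈ A → ω' ∈ A)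
    (hle : ((1 - (prodBernoulli w).real {ω : BondConfig V | ∀ p ∈ ({s} : Set V), ∀ q ∈ T, ¬ (openGraph ω).Reachable p q}) *
            (prodBernoulli w).real Aᶜ +
          (prodBernoulli w).real ({ω : BondConfig V | ∀ p ∈ ({s} : Set V), ∀ q ∈ T, ¬ (openGraph ω).Reachable p q} ∩ Aᶜ)) *
          (prodBernoulli w).real ({ω : BondConfig V | (openGraph ω).Reachable y s} ∩
            {ω : BondConfig V | ∀ t ∈ T, ¬ (openGraph ω).Reachable y t}) ≤
      (2 - (prodBernoulli w).real {ω : BondConfig V | ∀ p ∈ ({s} : Set V), ∀ q ∈ T, ¬ (openGraph ω).Reachable p q}) *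
          (prodBernoulli w).real (Aᶜ ∩ ({ω : BondConfig V | (openGraph ω).Reachable y s} ∩
            {ω : BondConfig V | ∀ t ∈ T, ¬ (openGraph ω).Reachable y t}))) :
    0 ≤ sahiE3 (prodBernoulli w) {ω : BondConfig V | ∀ p ∈ ({s} : Set V), ∀ q ∈ T, ¬ (openGraph ω).Reachable p q} Aᶜ
        {ω : BondConfig V | ∀ t ∈ T, ¬ (openGraph ω).Reachable y t} := by
  have h := sahiE3_sep_clusterMonoCompl_notReach_ge w s y T A hA
  linarith

/-! ### The PATH row `(D[s|t], D[s|x], D[t|y])` under the side condition -/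

omit [Fintype V] in
/-- `{s ↔ x}` is an increasing function of the cluster of `s`. [folklore] -/
theorem openConn_clusterMono (s x : V) :
    ∀ ⦃ω ω' : BondConfig V⦄,
      (⋃ v ∈ ({s} : Set V), openEdgeCluster ω v) ⊆ (⋃ v ∈ ({s} : Set V), openEdgeCluster ω' v) →
      ω ∈ openConn s x → ω' ∈ openConn s x := by
  intro ω ω' hsub hω
  simp only [Set.mem_singleton_iff, Set.iUnion_iUnion_eq_left] at hsub
  change (openGraph ω').Reachable s x
  have h : (openGraph ω).Reachable s x := hω
  rcases (reachable_iff_exists_mem_openEdgeCluster ω s x).1 h with hxs | ⟨e, he, hxe⟩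
  · subst hxs; exact SimpleGraph.Reachable.refl _
  · exact (reachable_iff_exists_mem_openEdgeCluster ω' s x).2 (Or.inr ⟨e, hsub he, hxe⟩)

omit [Fintype V] in
/-- `{s ↮ t}` written with the singleton source set. [folklore] -/
theorem sep_singleton_singleton (s t : V) :
    {ω : BondConfig V | ∀ p ∈ ({s} : Set V), ∀ q ∈ ({t} : Set V), ¬ (openGraph ω).Reachable p q} = (openConn s t)ᶜ := by
  ext ω; simp [openConn]

omit [Fintype V] in
/-- `{y ↮ t}` written with the singleton terminal set, as the complement of `{t ↔ y}`. [folklore] -/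
theorem notReach_singleton (t y : V) :
    {ω : BondConfig V | ∀ q ∈ ({t} : Set V), ¬ (openGraph ω).Reachable y q} = (openConn t y)ᶜ := by
  ext ω
  simp only [Set.mem_setOf_eq, Set.mem_singleton_iff, forall_eq, Set.mem_compl_iff, openConn]
  exact ⟨fun h h' => h h'.symm, fun h h' => h h'.symm⟩

/-- **The PATH row on EVERY finite weighted graph under the side condition** "`y` does not attract `x`":
if `((1 − P(s↮t))·P(s↮x) + P(s↮t ∧ s↮x))·P(y↔s ∧ y↮t) ≤ (2 − P(s↮t))·P(s↮x ∧ y↔s ∧ y↮t)` then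
`0 ≤ E₃({s↮t}, {s↮x}, {t↮y})` (no distinctness, no bound on the number of vertices). [this work] -/
theorem frontier_path_all_of_le (w : Sym2 V → unitInterval) (s t x y : V)
    (hle : ((1 - (prodBernoulli w).real (openConn s t)ᶜ) * (prodBernoulli w).real (openConn s x)ᶜ +
          (prodBernoulli w).real ((openConn s t)ᶜ ∩ (openConn s x)ᶜ)) *
          (prodBernoulli w).real ({ω : BondConfig V | (openGraph ω).Reachable y s} ∩ (openConn t y)ᶜ) ≤
      (2 - (prodBernoulli w).real (openConn s t)ᶜ) *
          (prodBernoulli w).real ((openConn s x)ᶜ ∩ ({ω : BondConfig V | (openGraph ω).Reachable y s} ∩ (openConn t y)ᶜ))) :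
    0 ≤ sahiE3 (prodBernoulli w) (openConn s t)ᶜ (openConn s x)ᶜ (openConn t y)ᶜ := by
  have h := sahiE3_sep_clusterMonoCompl_notReach_nonneg_of_le w s y ({t} : Set V) (openConn s x) (openConn_clusterMono s x)
  rw [sep_singleton_singleton, notReach_singleton] at h
  exact h hle

end ClusterBHK3Hitting

end Summit.CriticalPhenomena.PercolationContinuityZ3.Theorems
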